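import Literature.MathematicalPhysics.KineticTheory.KickMatchedOrbitBookkeeping
import Literature.MathematicalPhysics.KineticTheory.KickMatchedAdmissibleFlux
import Literature.MathematicalPhysics.KineticTheory.DiceSplitting
import HarnessLib

/-!
# The hybrid restart step of the chronological one-kick swap, as a path identity

Topic `Literature/MathematicalPhysics/KineticTheory`. Node B3 (deterministic half) of the lemma DAG of stub S3a
`SwapIdentity` of the crux line `stein-lindeberg-kick-swap` (`InformationPercolationEngine.PercolationClosesChaos`,
stmt-AtomisticToContinuum-13914). The `k`-th HYBRID of the Stein–Lindeberg swap for the kick-matched gas `Z*` is the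
continuation path `contPath z k ω u`: the true orbit before its `k`-th collision, then `Z*` (dice `u`) restarted from
the pre-collisional configuration `preAt z k` resolved with the kick `ω`. Consecutive hybrids match PATHWISE:

* `Driven.step_eq_of_isSimpleIncomingWith` — a driven step from a configuration whose free flight exits onto a simple
  incoming configuration applies the rule to ITS colliding pair (no choice);
* `step_postAt`, `step_self` — hence the first driven step of ANY noise-driven gas started at the post-collisional
  configuration `postAt z k` of a good orbit (resp. at the datum `z`) resolves the orbit's NEXT contact
  `preAt z (k+1)` (resp. `preAt z 0`) of the pair `pairAt z (k+1)` (resp. `pairAt z 0`) with the first die;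
* `contPath_trueKick_eq_contPath_succ` — resolving collision `k` the TRUE way and running `Z*` with dice `u` is the
  same path as keeping the orbit through collision `k+1`'s approach, resolving contact `k+1` with the resampled normal
  `kmNormal (preAt z (k+1)) (u 0)` and running `Z*` with the remaining dice `u ∘ succ` (restart identity
  `Driven.flow_restart` + free flight before the first instant), for every time `s` up to which the instants of the
  restarted gas do not accumulate; `kmFlow_eq_contPath_zero` — the same from the datum (`Z*` itself is the `0`-th
  comparison hybrid); `defect`-level corollaries `defect_contPath_trueKick_eq`, `starDefect_eq_defect_contPath_zero`;
* `contPath_trueKick_eqOn_last`, `swapValue_trueKick_last`, `kmFlow_eqOn_of_numColl_eq_zero`,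
  `starDefect_eq_trueDefect_of_numColl_eq_zero` — after the last collision in `(0, τ]` the continuation is the
  orbit's free flight up to `τ`, so the last hybrid is the true statistic (and with no collision `Z* = Φ` on `[0, τ]`);
* `fluxLaw_isAdmissible_preAt_ne_zero` — at every genuine collision of a good orbit the admissible kicks have
  positive flux measure (so `restrictedMean` is a genuine mean), from `fluxLaw_setOf_isAdmissible_ne_zero`;
* `map_uncons_kmDice`, `integral_kmDice_eq_integral_prod` — the dice of `Z*` split as (first die) ⊗ (the rest)
  (`KernelGas.map_uncons_dice`), the measure-theoretic half of the restart step.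

References: C. Cercignani, R. Illner, M. Pulvirenti, *The Mathematical Theory of Dilute Gases* (1994), App. 4.A (the
collision recursion / special-flow representation) [CIP1994]; S. Chatterjee, *A generalization of the Lindeberg
principle*, Ann. Probab. 34 (2006) (swap one input at a time) [Chatterjee2006].
-/

noncomputable section

open scoped BigOperators ENNReal Topology RealInnerProductSpace
open MeasureTheory Set Filter Function
open Literature.Analysis.FluidPDE

/-! ## A driven step at a simple incoming exit configuration -/

namespace Literature.MathematicalPhysics.KineticTheory.Driven

variable {d : Type*} [Fintype d] {X : Type*} {N : ℕ} {Ξ : Type*}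
variable {G : Geometry d X} {ε : ℝ} {R : Fin N → Fin N → Config N d X → Ξ → Config N d X}

/-- **The driven step at a simple incoming exit configuration** applies the rule to its colliding pair: if the free
flight from `z` exits (at a finite time) onto a configuration whose only contact pair is the incoming `p = (i, j)`,
`i < j`, then `step ξ z = R i j (S_{τ(z)} z) ξ` (`incomingPairs = {p}`, so `Set.Nonempty.some` is not a choice).
[folklore] -/
theorem step_eq_of_isSimpleIncomingWith {ξ : Ξ} {z : Config N d X} (hτ : Alexander.freeExitTime G ε z ≠ ∞)
    {p : Fin N × Fin N}
    (hp : Alexander.IsSimpleIncomingWith G ε (freeFlight G (Alexander.freeExitTime G ε z).toReal z) p) :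
    step G ε R ξ z = R p.1 p.2 (freeFlight G (Alexander.freeExitTime G ε z).toReal z) ξ := by
  have hne : (Alexander.incomingPairs G ε (freeFlight G (Alexander.freeExitTime G ε z).toReal z)).Nonempty :=
    ⟨p, by rw [hp.incomingPairs_eq]; rfl⟩
  have hsome : hne.some = p := hp.incomingPairs_eq.subset hne.some_mem
  simp only [step, hτ, if_false]
  rw [dif_pos hne, hsome]

end Literature.MathematicalPhysics.KineticTheory.Driven

namespace Literature.MathematicalPhysics.KineticTheory.KickMatchedHardSphereGas

variable {σ : ℝ} {N : ℕ}

/-! ## The first driven step from a configuration of a good orbit -/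

/-- **The first step of a driven gas from a post-collisional configuration of a good orbit**: if
`collTime k < collTime (k+1)` are collision times of the orbit of `z ∈ Φ.good`, then for ANY pair rule `R` and die
`ξ`, `Driven.step R ξ (postAt z k) = R i j (preAt z (k+1)) ξ` with `(i, j) = pairAt z (k+1)` — the driven gas meets the
orbit's next contact and resolves it with its own rule (`hsDiameter σ N < 1/2`). [folklore] -/
theorem step_postAt {Ξ : Type*} (hε2 : hsDiameter σ N < 2⁻¹) (Φ : Flow σ N) {z : Cfg N} (hz : z ∈ Φ.good) {k : ℕ}
    (hk1 : collTime σ N Φ z (k + 1) ∈ collisionTimes geo (hsDiameter σ N) fun t => Φ.flow t z)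
    (hlt : collTime σ N Φ z k < collTime σ N Φ z (k + 1))
    (R : Fin (N + 1) → Fin (N + 1) → Cfg N → Ξ → Cfg N) (ξ : Ξ) :
    Driven.step geo (hsDiameter σ N) R ξ (postAt σ N Φ z k) =
      R (pairAt σ N Φ z (k + 1)).1 (pairAt σ N Φ z (k + 1)).2 (preAt σ N Φ z (k + 1)) ξ := by
  obtain ⟨hτ, hff, -⟩ := freeExitTime_postAt hε2 Φ hz hk1 hlt
  have hτ' : (Alexander.freeExitTime geo (hsDiameter σ N) (postAt σ N Φ z k)).toReal =
      collTime σ N Φ z (k + 1) - collTime σ N Φ z k := by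
    rw [hτ, ENNReal.toReal_ofReal (sub_pos.2 hlt).le]
  have hp := isSimpleIncomingWith_preAt hε2 Φ hz hk1
  rw [← hff, ← hτ'] at hp
  rw [Driven.step_eq_of_isSimpleIncomingWith (by rw [hτ]; exact ENNReal.ofReal_ne_top) hp, hτ', hff]

/-- **The first step of a driven gas from the datum of a good orbit**: if the first collision time `collTime 0 > 0`
is genuine, `Driven.step R ξ z = R i j (preAt z 0) ξ` with `(i, j) = pairAt z 0`. [folklore] -/
theorem step_self {Ξ : Type*} (hε2 : hsDiameter σ N < 2⁻¹) (Φ : Flow σ N) {z : Cfg N} (hz : z ∈ Φ.good)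
    (h0 : collTime σ N Φ z 0 ∈ collisionTimes geo (hsDiameter σ N) fun t => Φ.flow t z)
    (hpos : 0 < collTime σ N Φ z 0) (R : Fin (N + 1) → Fin (N + 1) → Cfg N → Ξ → Cfg N) (ξ : Ξ) :
    Driven.step geo (hsDiameter σ N) R ξ z = R (pairAt σ N Φ z 0).1 (pairAt σ N Φ z 0).2 (preAt σ N Φ z 0) ξ := by
  obtain ⟨hτ, hff, -⟩ := freeExitTime_self hε2 Φ hz h0 hpos
  have hτ' : (Alexander.freeExitTime geo (hsDiameter σ N) z).toReal = collTime σ N Φ z 0 := by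
    rw [hτ, ENNReal.toReal_ofReal hpos.le]
  have hp := isSimpleIncomingWith_preAt hε2 Φ hz h0
  rw [← hff, ← hτ'] at hp
  rw [Driven.step_eq_of_isSimpleIncomingWith (by rw [hτ]; exact ENNReal.ofReal_ne_top) hp, hτ', hff]

/-! ## Consecutive hybrids agree pathwise -/

/-- **The hybrid restart identity (path level).** Let `z ∈ Φ.good`, `collTime k < collTime (k+1)` collision times
of its orbit, `u` a dice sequence, `s` a time; assume that if `s ≥ collTime (k+1)` the instants of `Z*` started at
`postAt z k` with dice `u` do not accumulate up to `s − collTime k`. Then resolving collision `k` with the TRUE kick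
and running `Z*` with dice `u` gives at time `s` the same configuration as keeping the true orbit up to collision
`k+1`, resolving that contact with the resampled normal `kmNormal (preAt z (k+1)) (u 0)`, and running `Z*` with the
remaining dice `u ∘ succ`: `contPath z k (trueKick z k) u s = contPath z (k+1) (kmNormal … (u 0)) (u ∘ succ) s`.
(Kicking with the true kick reproduces `postAt z k`; before its first instant `collTime (k+1) − collTime k` the
restarted gas is the orbit's free flight; at it, its first step resolves `preAt z (k+1)` with the die `u 0`
(`step_postAt`); afterwards `Driven.flow_restart`.) `0 < hsDiameter σ N < 1/2`. [folklore] -/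
theorem contPath_trueKick_eq_contPath_succ (hε : 0 < hsDiameter σ N) (hε2 : hsDiameter σ N < 2⁻¹) (Φ : Flow σ N)
    {z : Cfg N} (hz : z ∈ Φ.good) {k : ℕ}
    (hk : collTime σ N Φ z k ∈ collisionTimes geo (hsDiameter σ N) fun t => Φ.flow t z)
    (hk1 : collTime σ N Φ z (k + 1) ∈ collisionTimes geo (hsDiameter σ N) fun t => Φ.flow t z)
    (hlt : collTime σ N Φ z k < collTime σ N Φ z (k + 1)) (u : ℕ → Die) {s : ℝ}
    (hacc : collTime σ N Φ z (k + 1) ≤ s → ∃ K, ENNReal.ofReal (s - collTime σ N Φ z k) <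
      Driven.instant geo (hsDiameter σ N) (kmRule σ N) u (postAt σ N Φ z k) K) :
    contPath σ N Φ z k (trueKick σ N Φ z k) u s =
      contPath σ N Φ z (k + 1)
        (kmNormal σ N (pairAt σ N Φ z (k + 1)).1 (pairAt σ N Φ z (k + 1)).2 (preAt σ N Φ z (k + 1)) (u 0))
        (fun n => u (n + 1)) s := by
  obtain ⟨hτ, -, -⟩ := freeExitTime_postAt hε2 Φ hz hk1 hlt
  have hkick := (isAdmissible_trueKick hε hε2 Φ hz hk).2
  have hinst : Driven.instant geo (hsDiameter σ N) (kmRule σ N) u (postAt σ N Φ z k) 1 =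
      ENNReal.ofReal (collTime σ N Φ z (k + 1) - collTime σ N Φ z k) := by
    rw [Driven.instant_one, hτ]
  have hstate : Driven.stateAfter geo (hsDiameter σ N) (kmRule σ N) u (postAt σ N Φ z k) 1 =
      kickAt σ N (pairAt σ N Φ z (k + 1)).1 (pairAt σ N Φ z (k + 1)).2
        (kmNormal σ N (pairAt σ N Φ z (k + 1)).1 (pairAt σ N Φ z (k + 1)).2 (preAt σ N Φ z (k + 1)) (u 0))
        (preAt σ N Φ z (k + 1)) := by
    rw [Driven.stateAfter_succ, Driven.stateAfter_zero, step_postAt hε2 Φ hz hk1 hlt]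
    rfl
  unfold contPath
  by_cases hs0 : s < collTime σ N Φ z k
  · rw [if_pos hs0, if_pos (hs0.trans hlt)]
  rw [if_neg hs0, hkick]
  unfold kmFlow
  by_cases hs1 : s < collTime σ N Φ z (k + 1)
  · rw [if_pos hs1, Driven.flow_eq_freeFlight_of_lt_instant_one
      (by rw [hinst]; exact (ENNReal.ofReal_lt_ofReal_iff (sub_pos.2 hlt)).2 (by linarith)),
      flow_eq_freeFlight_postAt Φ hz (not_lt.1 hs0) hs1]
  · rw [if_neg hs1, Driven.flow_restart (by rw [hinst]; exact ENNReal.ofReal_le_ofReal (by linarith))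
      (hacc (not_lt.1 hs1)), hstate, hinst, ENNReal.toReal_ofReal (sub_pos.2 hlt).le]
    congr 1
    ring

/-- **`Z*` itself is the `0`-th comparison hybrid (path level).** For `z ∈ Φ.good` with a genuine first collision
time `collTime 0 > 0`, a dice sequence `u` and `s ≥ 0` such that, if `s ≥ collTime 0`, the instants of `Z*` from `z`
do not accumulate up to `s`: `kmFlow u z s = contPath z 0 (kmNormal (preAt z 0) (u 0)) (u ∘ succ) s` — `Z*` follows
the orbit's free flight to its first contact `preAt z 0`, resolves it with the resampled normal driven by `u 0`
(`step_self`), and continues as `Z*` with dice `u ∘ succ` (`Driven.flow_restart`). [folklore] -/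
theorem kmFlow_eq_contPath_zero (hε2 : hsDiameter σ N < 2⁻¹) (Φ : Flow σ N) {z : Cfg N} (hz : z ∈ Φ.good)
    (h0 : collTime σ N Φ z 0 ∈ collisionTimes geo (hsDiameter σ N) fun t => Φ.flow t z)
    (hpos : 0 < collTime σ N Φ z 0) (u : ℕ → Die) {s : ℝ} (hs : 0 ≤ s)
    (hacc : collTime σ N Φ z 0 ≤ s → ∃ K, ENNReal.ofReal s < Driven.instant geo (hsDiameter σ N) (kmRule σ N) u z K) :
    kmFlow σ N u z s =
      contPath σ N Φ z 0 (kmNormal σ N (pairAt σ N Φ z 0).1 (pairAt σ N Φ z 0).2 (preAt σ N Φ z 0) (u 0))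
        (fun n => u (n + 1)) s := by
  obtain ⟨hτ, -, -⟩ := freeExitTime_self hε2 Φ hz h0 hpos
  have hinst : Driven.instant geo (hsDiameter σ N) (kmRule σ N) u z 1 = ENNReal.ofReal (collTime σ N Φ z 0) := by
    rw [Driven.instant_one, hτ]
  have hstate : Driven.stateAfter geo (hsDiameter σ N) (kmRule σ N) u z 1 =
      kickAt σ N (pairAt σ N Φ z 0).1 (pairAt σ N Φ z 0).2
        (kmNormal σ N (pairAt σ N Φ z 0).1 (pairAt σ N Φ z 0).2 (preAt σ N Φ z 0) (u 0)) (preAt σ N Φ z 0) := by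
    rw [Driven.stateAfter_succ, Driven.stateAfter_zero, step_self hε2 Φ hz h0 hpos]
    rfl
  unfold contPath kmFlow
  by_cases hs1 : s < collTime σ N Φ z 0
  · rw [if_pos hs1, Driven.flow_eq_freeFlight_of_lt_instant_one
      (by rw [hinst]; exact (ENNReal.ofReal_lt_ofReal_iff hpos).2 hs1), flow_eq_freeFlight_self Φ hz hs hs1]
  · rw [if_neg hs1, Driven.flow_restart (by rw [hinst]; exact ENNReal.ofReal_le_ofReal (not_lt.1 hs1))
      (hacc (not_lt.1 hs1)), hstate, hinst, ENNReal.toReal_ofReal hpos.le]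

/-- **Consecutive hybrids have the same defect** (the `defect` reads the path on `[0, τ]` only): under
non-accumulation of the instants of `Z*` from `postAt z k` up to `τ − collTime k`,
`defect (contPath z k (trueKick z k) u) = defect (contPath z (k+1) (kmNormal … (u 0)) (u ∘ succ))`. [folklore] -/
theorem defect_contPath_trueKick_eq (hε : 0 < hsDiameter σ N) (hε2 : hsDiameter σ N < 2⁻¹) (Φ : Flow σ N)
    {z : Cfg N} (hz : z ∈ Φ.good) {k : ℕ}
    (hk : collTime σ N Φ z k ∈ collisionTimes geo (hsDiameter σ N) fun t => Φ.flow t z)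
    (hk1 : collTime σ N Φ z (k + 1) ∈ collisionTimes geo (hsDiameter σ N) fun t => Φ.flow t z)
    (hlt : collTime σ N Φ z k < collTime σ N Φ z (k + 1)) (u : ℕ → Die) {τ : ℝ} (χ : ℝ × T3 → ℝ)
    (Ψ : V3 × V3 × V3 → ℝ) (r : ℝ)
    (hacc : ∃ K, ENNReal.ofReal (τ - collTime σ N Φ z k) <
      Driven.instant geo (hsDiameter σ N) (kmRule σ N) u (postAt σ N Φ z k) K) :
    defect σ N τ χ Ψ r (contPath σ N Φ z k (trueKick σ N Φ z k) u) =
      defect σ N τ χ Ψ r (contPath σ N Φ z (k + 1)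
        (kmNormal σ N (pairAt σ N Φ z (k + 1)).1 (pairAt σ N Φ z (k + 1)).2 (preAt σ N Φ z (k + 1)) (u 0))
        fun n => u (n + 1)) := by
  refine defect_congr fun s hs => contPath_trueKick_eq_contPath_succ hε hε2 Φ hz hk hk1 hlt u fun _ => ?_
  obtain ⟨K, hK⟩ := hacc
  exact ⟨K, lt_of_le_of_lt (ENNReal.ofReal_le_ofReal (by linarith [hs.2])) hK⟩

/-- **The `Z*` defect is the defect of the `0`-th comparison hybrid**: under non-accumulation of the instants of `Z*`
from `z` up to `τ`, `starDefect (z, u) = defect (contPath z 0 (kmNormal (preAt z 0) (u 0)) (u ∘ succ))`. [folklore] -/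
theorem starDefect_eq_defect_contPath_zero (hε2 : hsDiameter σ N < 2⁻¹) (Φ : Flow σ N) {z : Cfg N} (hz : z ∈ Φ.good)
    (h0 : collTime σ N Φ z 0 ∈ collisionTimes geo (hsDiameter σ N) fun t => Φ.flow t z)
    (hpos : 0 < collTime σ N Φ z 0) (u : ℕ → Die) {τ : ℝ} (χ : ℝ × T3 → ℝ) (Ψ : V3 × V3 × V3 → ℝ) (r : ℝ)
    (hacc : ∃ K, ENNReal.ofReal τ < Driven.instant geo (hsDiameter σ N) (kmRule σ N) u z K) :
    starDefect σ N τ χ Ψ r (z, u) =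
      defect σ N τ χ Ψ r (contPath σ N Φ z 0
        (kmNormal σ N (pairAt σ N Φ z 0).1 (pairAt σ N Φ z 0).2 (preAt σ N Φ z 0) (u 0)) fun n => u (n + 1)) := by
  refine defect_congr fun s hs => kmFlow_eq_contPath_zero hε2 Φ hz h0 hpos u hs.1 fun _ => ?_
  obtain ⟨K, hK⟩ := hacc
  exact ⟨K, lt_of_le_of_lt (ENNReal.ofReal_le_ofReal hs.2) hK⟩

/-! ## The last hybrid is the true statistic -/

/-- **After the last collision the continuation is the orbit**: if `numColl = M + 1`, the continuation path of the
`M`-th swap with the TRUE kick agrees with the orbit on `[0, τ]` for every dice sequence (after `collTime M` the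
restarted `Z*` is in free flight up to `τ`, like the orbit). `0 < hsDiameter σ N < 1/2`. [folklore] -/
theorem contPath_trueKick_eqOn_last (hε : 0 < hsDiameter σ N) (hε2 : hsDiameter σ N < 2⁻¹) (Φ : Flow σ N)
    {z : Cfg N} (hz : z ∈ Φ.good) {τ : ℝ} {M : ℕ} (hM : numColl σ N Φ τ z = M + 1) (u : ℕ → Die) :
    EqOn (contPath σ N Φ z M (trueKick σ N Φ z M) u) (fun s => Φ.flow s z) (Icc 0 τ) := by
  intro s hs
  have hMlt : M < numColl σ N Φ τ z := by rw [hM]; exact Nat.lt_succ_self M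
  have hk := (collTime_mem Φ hz hMlt).1
  have hkick := (isAdmissible_trueKick hε hε2 Φ hz hk).2
  show (if s < collTime σ N Φ z M then Φ.flow s z else kmFlow σ N u
    (kickAt σ N (pairAt σ N Φ z M).1 (pairAt σ N Φ z M).2 (trueKick σ N Φ z M) (preAt σ N Φ z M))
    (s - collTime σ N Φ z M)) = Φ.flow s z
  by_cases hsM : s < collTime σ N Φ z M
  · rw [if_pos hsM]
  rw [if_neg hsM, hkick]
  obtain ⟨hflow, hexit⟩ := flow_eq_freeFlight_postAt_last hε2 Φ hz hM (not_lt.1 hsM) hs.2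
  unfold kmFlow
  rw [Driven.flow_eq_freeFlight_of_lt_instant_one, hflow]
  rw [Driven.instant_one]
  exact lt_of_le_of_lt (ENNReal.ofReal_le_ofReal (by linarith [hs.2])) hexit

/-- **The last hybrid is the true statistic**: if `numColl = M + 1` then
`swapValue … z M (trueKick z M) = φ_η(D_true z)`. [folklore] -/
theorem swapValue_trueKick_last (hε : 0 < hsDiameter σ N) (hε2 : hsDiameter σ N < 2⁻¹) (Φ : Flow σ N) {τ : ℝ}
    (χ : ℝ × T3 → ℝ) (Ψ : V3 × V3 × V3 → ℝ) (r η : ℝ) {z : Cfg N} (hz : z ∈ Φ.good) {M : ℕ}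
    (hM : numColl σ N Φ τ z = M + 1) :
    swapValue σ N Φ τ χ Ψ r η z M (trueKick σ N Φ z M) = phiEta η (trueDefect σ N Φ τ χ Ψ r z) :=
  swapValue_eq_of_eqOn Φ χ Ψ r η fun u => contPath_trueKick_eqOn_last hε hε2 Φ hz hM u

/-- **No collision in `(0, τ]`: `Z*` is the orbit on `[0, τ]`** for every dice sequence (both are the free flight of
`z`, whose exit time exceeds `τ`). [folklore] -/
theorem kmFlow_eqOn_of_numColl_eq_zero (hε2 : hsDiameter σ N < 2⁻¹) (Φ : Flow σ N) {z : Cfg N} (hz : z ∈ Φ.good)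
    {τ : ℝ} (h0 : numColl σ N Φ τ z = 0) (u : ℕ → Die) : EqOn (kmFlow σ N u z) (fun s => Φ.flow s z) (Icc 0 τ) := by
  intro s hs
  obtain ⟨hflow, hexit⟩ := flow_eq_freeFlight_self_of_numColl_eq_zero hε2 Φ hz h0 hs.1 hs.2
  show Driven.flow geo (hsDiameter σ N) (kmRule σ N) u z s = Φ.flow s z
  rw [Driven.flow_eq_freeFlight_of_lt_instant_one, hflow]
  rw [Driven.instant_one]
  exact lt_of_le_of_lt (ENNReal.ofReal_le_ofReal hs.2) hexit

/-- With no collision in `(0, τ]` the `Z*` defect is the true defect, for every dice sequence. [folklore] -/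
theorem starDefect_eq_trueDefect_of_numColl_eq_zero (hε2 : hsDiameter σ N < 2⁻¹) (Φ : Flow σ N) {z : Cfg N}
    (hz : z ∈ Φ.good) {τ : ℝ} (h0 : numColl σ N Φ τ z = 0) (χ : ℝ × T3 → ℝ) (Ψ : V3 × V3 × V3 → ℝ) (r : ℝ)
    (u : ℕ → Die) : starDefect σ N τ χ Ψ r (z, u) = trueDefect σ N Φ τ χ Ψ r z :=
  defect_congr (kmFlow_eqOn_of_numColl_eq_zero hε2 Φ hz h0 u)

/-! ## The restricted reference is a genuine mean; the dice split -/

/-- **At every genuine collision of a good orbit the admissible kicks have positive flux measure**: the restricted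
reference mean `restrictedMean z k` is a genuine normalised average (`0 < hsDiameter σ N < 1/2`). [folklore] -/
theorem fluxLaw_isAdmissible_preAt_ne_zero (hε : 0 < hsDiameter σ N) (hε2 : hsDiameter σ N < 2⁻¹) (Φ : Flow σ N)
    {z : Cfg N} (hz : z ∈ Φ.good) {k : ℕ}
    (hk : collTime σ N Φ z k ∈ collisionTimes geo (hsDiameter σ N) fun t => Φ.flow t z) :
    fluxLaw ((preAt σ N Φ z k) (pairAt σ N Φ z k).1).2 ((preAt σ N Φ z k) (pairAt σ N Φ z k).2).2
      {ω : Metric.sphere (0 : V3) 1 |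
        IsAdmissible σ N (pairAt σ N Φ z k).1 (pairAt σ N Φ z k).2 (ω : V3) (preAt σ N Φ z k)} ≠ 0 :=
  fluxLaw_setOf_isAdmissible_ne_zero hε hε2 (isSimpleIncomingWith_preAt hε2 Φ hz hk)

/-- **The dice of `Z*` split as (first die) ⊗ (remaining dice)**: `kmDice ∘ (u ↦ (u 0, u ∘ succ))⁻¹ =
(dice discLaw) ⊗ kmDice`. [folklore] -/
theorem map_uncons_kmDice :
    kmDice.map (fun u : ℕ → Die => (u 0, fun n => u (n + 1))) = (KernelGas.dice discLaw).prod kmDice := by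
  unfold kmDice
  exact KernelGas.map_uncons_dice _

/-- **Conditioning a `kmDice` expectation on the first die**:
`∫ F dkmDice = ∫ F (cons d v) d((dice discLaw) ⊗ kmDice)(d, v)`. [folklore] -/
theorem integral_kmDice_eq_integral_prod {E : Type*} [NormedAddCommGroup E] [NormedSpace ℝ E] (F : (ℕ → Die) → E) :
    ∫ u, F u ∂kmDice = ∫ q, F (fun n => (Nat.casesOn n q.1 q.2 : Die)) ∂((KernelGas.dice discLaw).prod kmDice) := by
  unfold kmDice
  exact KernelGas.integral_dice_eq_integral_prod _ F

end Literature.MathematicalPhysics.KineticTheory.KickMatchedHardSphereGas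

end
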